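import Summits.QuantumFields.BalabanUV.Beta.FP.CoarseCovarianceStripW

/-!
# `BalabanUV.Beta.FP.CoarseCovarianceStripWReg` — road «FP» (binder row D1), row H′2-IR ∕ IR-2 (ii), file (W) part 2: **the `2π`-periodic
# continuum weight `W_∞^{per}` is CONTINUOUS on the periodic strip `{|Im p_i| ≤ κ}` (`κ ≤ κ₁₆₆`) and HOLOMORPHIC IN EVERY COORDINATE SLICE
# on the open periodic strip `{|Im| < κ₁₆₆}`, across the seams `Re ≡ π (mod 2π)`, the other coordinates ANY points of the closed periodic strip**

HONEST FRAMING (cell contract, verbatim): «discharging `BetaPertH` makes Bałaban's UV stability UNCONDITIONAL — a real constructive-QFT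
result; it is NOT the continuum limit and NOT the Clay problem.»  HONEST DEPENDENCY (verbatim): «continuum YM on T⁴ ⇐ BetaPertH ∧ nine
spine estimates (0/9 proved); BetaPertH ⇐ (D1) ∧ (D4) ∧ CAP+tail; G-an2-4 gates asym, D1 and NE2/3/4.»  THIS MODULE DISCHARGES NOTHING of
D1 ∕ BetaPertH: [folklore] topology ∕ one-complex-variable bookkeeping (pasting continuous pieces over a finite cover, `nhdsWithin_iUnion`;
`Filter.EventuallyEq.differentiableAt_iff`) over part 1 (`Wper`, `W166Inf_tr`, `W166Inf_shiftS`, `W166Inf_update_add_two_pi`) and the tree's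
`continuousOn_W166Inf_strip` ∕ `differentiableAt_W166Inf_slice_fatStripO` BY NAME.  One set abbreviation (`piece`); no `def … : Prop`; nothing is
cited; 0 sorry.  NOT summit progress; NOT BetaPertH, NOT continuum, NOT Clay.

ABSOLUTE RULE (cell, verbatim): «No internally-minted statement may enter as a cited fact. Every hypothesis is either kernel-proved in this
package or a verbatim quotation of a PUBLISHED theorem with page reference. The manuscript(s) under audit are NOT citable for their own
disputed steps — they are the thing under adjudication; programme-internal (2001/route/tribunal) claims are never citable.»

CONTENT.
* §5 [our object] **`continuousOn_Wper`**: `ContinuousOn (Wper μ ν) (PStrip d κ)` for `0 ≤ κ ≤ κ₁₆₆(d)`, `μ ≠ ν`.  Proof: translate the point to the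
  fundamental cell `Re ∈ (−π, π]^d` (`Wper_sub_zsmul`); localise to the open box `−π < Re q_i < 3π`; there the periodic strip is the finite union over
  `S ⊆ {1..d}` of the pieces `piece d κ S` («`Re q_i > π` exactly on `S`»), on each of which `Wper = W_∞ ∘ shiftS S` (`wrapC_eq_shiftS`) is continuous;
  a piece whose closure contains the point has `Re q₀_i = π` on `S`, where the values agree by the several-coordinate side matching `W166Inf_shiftS`;
  `nhdsWithin_iUnion` + `tendsto_iSup` glue the pieces.
* §6 [our object] **`differentiableAt_Wper_update`**: for every `p` with all `|Im p_j| ≤ κ₁₆₆ d` and every `z` with `|Im z| < κ₁₆₆ d`,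
  `w ↦ Wper μ ν (update p i w)` is holomorphic at `z` (translate to the cell; off the seam `Wper = W_∞` near the point; on the seam `Re = π` the two
  branches agree near the point by `W166Inf_update_add_two_pi`; then `differentiableAt_W166Inf_slice_fatStripO`); `differentiableOn_Wper_update` on the
  open horizontal strip `{|Im w| < κ₁₆₆ d}`.
These are exactly the two inputs the strip analysis of the coarse covariance symbol needs from `W_∞` at ALIAS momenta `(k + 2πl)/n` (real parts up
to `2π`): joint continuity on the closed periodic strip (the `cont` field of `B4ContourShift.StripRegular` and Cauchy estimates with complex other
coordinates) and slice holomorphy (the `diff` field).  Unit `b2b-balaban-beta-d1-formalise-leaf-06` (gen 7), owner ruling R-FP-21 (A3)∕(C), INTENT l.22234.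
-/

noncomputable section

namespace Summit.QuantumFields.BalabanUV.Beta.FP.CoarseCovarianceStripWReg

open Filter Topology Finset Complex Set Metric
open scoped BigOperators
open Literature.MathematicalPhysics.QuantumFieldTheory.Balaban1983to89
open B4Strip (Strip ofRealVec)
open B5Symbol166Strip (kappa166 kappa166_pos)
open Summit.QuantumFields.BalabanUV.Beta.FP.PerfectSymbol166 (W166Inf)
open Summit.QuantumFields.BalabanUV.Beta.FP.PerfectSymbol166HoloW (continuousOn_W166Inf_strip)
open Summit.QuantumFields.BalabanUV.Beta.FP.PerfectSymbol166StripReg (delta166 delta166_pos)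
open Summit.QuantumFields.BalabanUV.Beta.FP.PerfectSymbol166RealLine (sideNbhd delta166_le_pi)
open Summit.QuantumFields.BalabanUV.Beta.FP.CoarseCovarianceStripW

variable {d : ℕ}

/-! ## §5 Continuity on the periodic strip -/

/-- [folklore] the piece of the local chart indexed by `S`: real parts above `π` exactly on `S`. -/
def piece (d : ℕ) (κ : ℝ) (S : Finset (Fin d)) : Set (Fin d → ℂ) :=
  {q | q ∈ PStrip d κ ∧ (∀ i, -Real.pi < (q i).re ∧ (q i).re < 3 * Real.pi) ∧ ∀ i, i ∈ S ↔ Real.pi < (q i).re}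

/-- [folklore] on the piece indexed by `S` the wrap is the shift by `−2π` on `S`. -/
theorem wrapC_eq_shiftS {κ : ℝ} {S : Finset (Fin d)} {q : Fin d → ℂ} (hq : q ∈ piece d κ S) : wrapC q = shiftS S q := by
  obtain ⟨_, hO, hS⟩ := hq
  funext i
  by_cases hi : i ∈ S
  · have h1 : Real.pi < (q i).re := (hS i).mp hi
    simp only [wrapC_apply, shiftS, hi, if_true]
    exact wrapRe_eq_sub_of_mem ⟨h1, by linarith [(hO i).2]⟩
  · have h1 : ¬ Real.pi < (q i).re := fun h => hi ((hS i).mpr h)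
    simp only [wrapC_apply, shiftS, hi, if_false]
    exact wrapRe_eq_self ⟨(hO i).1, not_lt.mp h1⟩

/-- [folklore] on the piece indexed by `S` the shifted point lies in the Brillouin strip. -/
theorem shiftS_mem_strip {κ : ℝ} {S : Finset (Fin d)} {q : Fin d → ℂ} (hq : q ∈ piece d κ S) : shiftS S q ∈ Strip d κ := by
  rw [← wrapC_eq_shiftS hq]; exact wrapC_mem_strip hq.1

/-- [folklore] `W_∞ ∘ shiftS S` is continuous on `{q | shiftS S q ∈ Strip d κ}`. -/
theorem continuousOn_W166Inf_shiftS {κ : ℝ} (hκ0 : 0 ≤ κ) (hκ : κ ≤ kappa166 d) (μ ν : Fin d) (S : Finset (Fin d)) :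
    ContinuousOn (fun q => W166Inf μ ν (shiftS S q)) {q | shiftS S q ∈ Strip d κ} := by
  have hc : Continuous (shiftS (d := d) S) := by
    apply continuous_pi
    intro i
    by_cases hi : i ∈ S
    · simp only [shiftS, hi, if_true]; exact (continuous_apply i).sub continuous_const
    · simp only [shiftS, hi, if_false]; exact continuous_apply i
  exact (continuousOn_W166Inf_strip hκ0 hκ μ ν).comp hc.continuousOn fun q hq => hq

/-- [folklore] continuity of `W^{per}` within one piece, at a point of the fundamental cell. -/
theorem continuousWithinAt_Wper_piece {κ : ℝ} (hκ0 : 0 ≤ κ) (hκ : κ ≤ kappa166 d) {μ ν : Fin d} (hμν : μ ≠ ν)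
    {q₀ : Fin d → ℂ} (hq₀ : q₀ ∈ PStrip d κ) (hcell : ∀ i, (q₀ i).re ∈ Set.Ioc (-Real.pi) Real.pi) (S : Finset (Fin d)) :
    ContinuousWithinAt (Wper μ ν) (piece d κ S) q₀ := by
  by_cases hS : ∀ i ∈ S, (q₀ i).re = Real.pi
  · -- the piece accumulates at `q₀`; there `Wper = W_∞ ∘ shiftS S`, continuous, with the right value by §3
    have hq₀S : q₀ ∈ Strip d κ := by rw [← wrapC_eq_self hcell]; exact wrapC_mem_strip hq₀
    have hsh : shiftS S q₀ ∈ Strip d κ := by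
      intro j
      by_cases hj : j ∈ S
      · simp only [shiftS, hj, if_true]
        refine ⟨?_, ?_⟩
        · have e : (q₀ j - 2 * (Real.pi : ℂ)).re = -Real.pi := by simp [hS j hj]; ring
          rw [e, abs_neg, abs_of_pos Real.pi_pos]
        · have e : (q₀ j - 2 * (Real.pi : ℂ)).im = (q₀ j).im := by simp
          rw [e]; exact (hq₀S j).2
      · simp only [shiftS, hj, if_false]; exact hq₀S j
    have hcont : ContinuousWithinAt (fun q => W166Inf μ ν (shiftS S q)) (piece d κ S) q₀ :=
      ((continuousOn_W166Inf_shiftS hκ0 hκ μ ν S) _ hsh).mono fun q hq => shiftS_mem_strip hq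
    refine hcont.congr (fun q hq => ?_) ?_
    · show Wper μ ν q = W166Inf μ ν (shiftS S q)
      rw [Wper, wrapC_eq_shiftS hq]
    · show Wper μ ν q₀ = W166Inf μ ν (shiftS S q₀)
      rw [Wper_eq_of_mem μ ν hcell, W166Inf_shiftS hκ0 hκ hμν S q₀ hq₀S hS]
  · -- the piece stays away from `q₀`
    push Not at hS
    obtain ⟨i, hiS, hne⟩ := hS
    have hlt : (q₀ i).re < Real.pi := lt_of_le_of_ne (hcell i).2 hne
    apply continuousWithinAt_of_notMem_closure
    intro hmem
    have hO : IsOpen {q : Fin d → ℂ | (q i).re < Real.pi} :=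
      isOpen_lt (Complex.continuous_re.comp (continuous_apply i)) continuous_const
    obtain ⟨q, hqlt, hq⟩ := mem_closure_iff.mp hmem _ hO hlt
    have h1 : Real.pi < (q i).re := (hq.2.2 i).mp hiS
    have h2 : (q i).re < Real.pi := hqlt
    exact absurd h1 (not_lt.mpr h2.le)

/-- [folklore] continuity of `W^{per}` within the periodic strip at a point of the fundamental cell. -/
theorem continuousWithinAt_Wper_cell {κ : ℝ} (hκ0 : 0 ≤ κ) (hκ : κ ≤ kappa166 d) {μ ν : Fin d} (hμν : μ ≠ ν)
    {q₀ : Fin d → ℂ} (hq₀ : q₀ ∈ PStrip d κ) (hcell : ∀ i, (q₀ i).re ∈ Set.Ioc (-Real.pi) Real.pi) :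
    ContinuousWithinAt (Wper μ ν) (PStrip d κ) q₀ := by
  -- localise to the open box `O = {−π < Re q_i < 3π}`
  set O : Set (Fin d → ℂ) := {q | ∀ i, -Real.pi < (q i).re ∧ (q i).re < 3 * Real.pi} with hOdef
  have hOopen : IsOpen O := by
    have e : O = ⋂ i, {q : Fin d → ℂ | -Real.pi < (q i).re ∧ (q i).re < 3 * Real.pi} := by
      ext q; simp [hOdef]
    rw [e]
    refine isOpen_iInter_of_finite fun i => ?_
    exact (isOpen_lt continuous_const (Complex.continuous_re.comp (continuous_apply i))).inter
      (isOpen_lt (Complex.continuous_re.comp (continuous_apply i)) continuous_const)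
  have hq₀O : q₀ ∈ O := fun i => ⟨(hcell i).1, by linarith [(hcell i).2, Real.pi_pos]⟩
  rw [← continuousWithinAt_inter (hOopen.mem_nhds hq₀O)]
  -- the localised strip is covered by the pieces
  have hcover : PStrip d κ ∩ O ⊆ ⋃ S : Finset (Fin d), piece d κ S := by
    intro q hq
    refine Set.mem_iUnion.mpr ⟨Finset.univ.filter fun i => Real.pi < (q i).re, hq.1, hq.2, fun i => ?_⟩
    simp
  refine ContinuousWithinAt.mono ?_ hcover
  -- continuity within a finite union
  have key : ∀ S : Finset (Fin d), ContinuousWithinAt (Wper μ ν) (piece d κ S) q₀ :=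
    fun S => continuousWithinAt_Wper_piece hκ0 hκ hμν hq₀ hcell S
  simp only [ContinuousWithinAt, nhdsWithin_iUnion] at key ⊢
  exact tendsto_iSup.mpr key

/-- [our object] **CONTINUITY OF THE PERIODIC WEIGHT ON THE PERIODIC STRIP**: `ContinuousOn (Wper μ ν) (PStrip d κ)` for `0 ≤ κ ≤ κ₁₆₆(d)`, `μ ≠ ν`. -/
theorem continuousOn_Wper {κ : ℝ} (hκ0 : 0 ≤ κ) (hκ : κ ≤ kappa166 d) {μ ν : Fin d} (hμν : μ ≠ ν) :
    ContinuousOn (Wper μ ν) (PStrip d κ) := by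
  intro p₀ hp₀
  -- translate to the fundamental cell
  set m : Fin d → ℤ := fun i => toIocDiv Real.two_pi_pos (-Real.pi) (p₀ i).re with hm
  set τ : (Fin d → ℂ) → (Fin d → ℂ) := fun p i => p i - (m i : ℂ) * (2 * Real.pi) with hτ
  have hW : Wper μ ν = Wper μ ν ∘ τ := by
    funext p; exact (Wper_sub_zsmul μ ν p m).symm
  have hτc : Continuous τ := continuous_pi fun i => (continuous_apply i).sub continuous_const
  have hmaps : Set.MapsTo τ (PStrip d κ) (PStrip d κ) := by
    intro p hp i
    have e : (τ p i).im = (p i).im := by simp [hτ]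
    rw [e]; exact hp i
  have hcell : ∀ i, (τ p₀ i).re ∈ Set.Ioc (-Real.pi) Real.pi := by
    intro i
    have e : (τ p₀ i).re = toIocMod Real.two_pi_pos (-Real.pi) (p₀ i).re := by
      have h := toIocMod_add_toIocDiv_zsmul Real.two_pi_pos (-Real.pi) (p₀ i).re
      rw [zsmul_eq_mul] at h
      have e1 : (τ p₀ i).re = (p₀ i).re - (m i : ℝ) * (2 * Real.pi) := by simp [hτ]
      rw [e1]
      simp only [hm]
      linarith
    rw [e]
    exact wrapRe_re_mem ⟨(p₀ i).re, 0⟩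
  rw [hW]
  exact (continuousWithinAt_Wper_cell hκ0 hκ hμν (hmaps hp₀) hcell).comp hτc.continuousWithinAt hmaps

/-! ## §6 Slice holomorphy on the periodic strip -/

/-- [our object] **SLICE HOLOMORPHY OF THE PERIODIC WEIGHT**, at a point of the fundamental cell: for `q ∈ PStrip d (κ₁₆₆ d)` with all
`Re q_j ∈ (−π, π]` and `|Im q_i| < κ₁₆₆ d`, `z ↦ W^{per}(update q i z)` is holomorphic at `q i` — across the seam `Re q_i = π` by §4. -/
theorem differentiableAt_Wper_update_cell {μ ν : Fin d} (hμν : μ ≠ ν) {q : Fin d → ℂ} (hq : q ∈ PStrip d (kappa166 d))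
    (hcell : ∀ j, (q j).re ∈ Set.Ioc (-Real.pi) Real.pi) (i : Fin d) (him : |(q i).im| < kappa166 d) :
    DifferentiableAt ℂ (fun z : ℂ => Wper μ ν (Function.update q i z)) (q i) := by
  have hqS : q ∈ Strip d (kappa166 d) := by rw [← wrapC_eq_self hcell]; exact wrapC_mem_strip hq
  have hδ := delta166_pos d
  have hκ := kappa166_pos d
  -- near `q i`, `Wper (update q i z) = W166Inf (update q i z)`
  have hev : (fun z : ℂ => Wper μ ν (Function.update q i z)) =ᶠ[𝓝 (q i)] fun z => W166Inf μ ν (Function.update q i z) := by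
    have hO : IsOpen {z : ℂ | -Real.pi < z.re ∧ z.re < Real.pi + delta166 d ∧ |z.im| < kappa166 d} :=
      (isOpen_lt continuous_const Complex.continuous_re).and
        ((isOpen_lt Complex.continuous_re continuous_const).and (isOpen_lt Complex.continuous_im.abs continuous_const))
    have hmem : q i ∈ {z : ℂ | -Real.pi < z.re ∧ z.re < Real.pi + delta166 d ∧ |z.im| < kappa166 d} :=
      ⟨(hcell i).1, by linarith [(hcell i).2], him⟩
    filter_upwards [hO.mem_nhds hmem] with z hz
    obtain ⟨hz1, hz2, hz3⟩ := hz
    show W166Inf μ ν (wrapC (Function.update q i z)) = W166Inf μ ν (Function.update q i z)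
    rw [wrapC_update, wrapC_eq_self hcell]
    by_cases hle : z.re ≤ Real.pi
    · rw [wrapRe_eq_self ⟨hz1, hle⟩]
    · push Not at hle
      rw [wrapRe_eq_sub_of_mem ⟨hle, by linarith [delta166_le_pi d]⟩]
      have hw : z - 2 * Real.pi ∈ sideNbhd (kappa166 d) (delta166 d) := by
        refine ⟨?_, ?_, ?_⟩
        · have e : (z - 2 * (Real.pi : ℂ)).re = z.re - 2 * Real.pi := by simp
          rw [e]; linarith
        · have e : (z - 2 * (Real.pi : ℂ)).re = z.re - 2 * Real.pi := by simp
          rw [e]; linarith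
        · have e : (z - 2 * (Real.pi : ℂ)).im = z.im := by simp
          rw [e]; linarith [abs_lt.mp hz3 |>.1, abs_lt.mp hz3 |>.2, abs_lt.mpr ⟨abs_lt.mp hz3 |>.1, abs_lt.mp hz3 |>.2⟩]
      have h := W166Inf_update_add_two_pi hμν hqS i hw
      rw [sub_add_cancel] at h
      exact h.symm
  refine (hev.differentiableAt_iff).mpr ?_
  exact differentiableAt_W166Inf_update hqS i ⟨by
    rw [abs_lt]; exact ⟨by linarith [(hcell i).1], by linarith [(hcell i).2]⟩, by linarith [him]⟩

/-- [our object] **SLICE HOLOMORPHY OF THE PERIODIC WEIGHT, EVERYWHERE ON THE OPEN PERIODIC STRIP**: for `p` with `|Im p_j| ≤ κ₁₆₆ d` (all `j`) and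
`|Im z| < κ₁₆₆ d`, `w ↦ W^{per}(μ,ν; update p i w)` is holomorphic at `z` (`μ ≠ ν`). -/
theorem differentiableAt_Wper_update {μ ν : Fin d} (hμν : μ ≠ ν) {p : Fin d → ℂ} (hp : p ∈ PStrip d (kappa166 d)) (i : Fin d)
    {z : ℂ} (hz : |z.im| < kappa166 d) :
    DifferentiableAt ℂ (fun w : ℂ => Wper μ ν (Function.update p i w)) z := by
  -- the point `p' := update p i z` and its translate to the fundamental cell
  set p' : Fin d → ℂ := Function.update p i z with hp'
  have hp'S : p' ∈ PStrip d (kappa166 d) := by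
    intro j
    by_cases hj : j = i
    · subst hj; simp only [hp', Function.update_self]; exact hz.le
    · simp only [hp', Function.update_of_ne hj]; exact hp j
  set m : Fin d → ℤ := fun j => toIocDiv Real.two_pi_pos (-Real.pi) (p' j).re with hm
  set q : Fin d → ℂ := fun j => p' j - (m j : ℂ) * (2 * Real.pi) with hqdef
  have hq : q ∈ PStrip d (kappa166 d) := by
    intro j
    have e : (q j).im = (p' j).im := by simp [hqdef]
    rw [e]; exact hp'S j
  have hcell : ∀ j, (q j).re ∈ Set.Ioc (-Real.pi) Real.pi := by
    intro j
    have e : (q j).re = toIocMod Real.two_pi_pos (-Real.pi) (p' j).re := by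
      have h := toIocMod_add_toIocDiv_zsmul Real.two_pi_pos (-Real.pi) (p' j).re
      rw [zsmul_eq_mul] at h
      have e1 : (q j).re = (p' j).re - (m j : ℝ) * (2 * Real.pi) := by simp [hqdef]
      rw [e1]
      simp only [hm]
      linarith
    rw [e]
    exact wrapRe_re_mem ⟨(p' j).re, 0⟩
  have hqi : |(q i).im| < kappa166 d := by
    have e : (q i).im = z.im := by simp [hqdef, hp']
    rw [e]; exact hz
  -- `w ↦ Wper (update p i w)` is `w ↦ Wper (update q i (w − c))`, `c = 2π m_i`
  set c : ℂ := (m i : ℂ) * (2 * Real.pi) with hc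
  have hfun : (fun w : ℂ => Wper μ ν (Function.update p i w)) = fun w => Wper μ ν (Function.update q i (w - c)) := by
    funext w
    rw [← Wper_sub_zsmul μ ν (Function.update p i w) m]
    congr 1
    funext j
    by_cases hj : j = i
    · subst hj; simp [hqdef, hc]
    · simp [hqdef, hp', Function.update_of_ne hj]
  rw [hfun]
  have hqz : q i = z - c := by simp [hqdef, hp', hc]
  have hd := differentiableAt_Wper_update_cell hμν hq hcell i hqi
  rw [hqz] at hd
  have h2 : DifferentiableAt ℂ (fun w : ℂ => w - c) z := differentiableAt_id.sub_const c
  have h3 := hd.comp z h2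
  simpa only [Function.comp_def] using h3

/-- [our object] consequently `w ↦ W^{per}(update p i w)` is holomorphic on the open horizontal strip `{|Im w| < κ₁₆₆ d}` (all real parts). -/
theorem differentiableOn_Wper_update {μ ν : Fin d} (hμν : μ ≠ ν) {p : Fin d → ℂ} (hp : p ∈ PStrip d (kappa166 d)) (i : Fin d) :
    DifferentiableOn ℂ (fun w : ℂ => Wper μ ν (Function.update p i w)) {w | |w.im| < kappa166 d} :=
  fun _ hw => (differentiableAt_Wper_update hμν hp i hw).differentiableWithinAt

end Summit.QuantumFields.BalabanUV.Beta.FP.CoarseCovarianceStripWReg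

end
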